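import Summits.QuantumFields.BalabanUV.Beta.ResolventPermutationStep

/-!
# `BalabanUV.Beta.PermutationLetters` — binder row D1, RULING R-D1-g25-2 (2): THE PERMUTATION LETTER CLASS hP = {HPS, HPW} OF THE RE-BASED LITERAL «JsB12Sym»
# — the binder SHAPES of record (`PermCovStencil`, `PermCovBiTable`, `PermInvKer`, `HPS`, `HPW`), the check that they feed
# `ResolventPermutationStep.permCovariant_flipK_TbalOf`'s (Sπ)∕(Wπ) VERBATIM, and their closure under the algebra of a dressing

HONEST FRAMING (cell contract, verbatim): «discharging `BetaPertH` makes Bałaban's UV stability UNCONDITIONAL — a real constructive-QFT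
result; it is NOT the continuum limit and NOT the Clay problem.»  THIS MODULE DISCHARGES NOTHING of `BetaPertH` ∕ row D1: it NAMES hypothesis
shapes (five `def … : Prop`, all [our object] predicates on OUR typed kernels∕jet data — no printed statement, nothing cited) and proves [folklore]
closure facts about them.  0 sorry.

AUTHORSHIP ∕ COURIER: the mathematics and the Lean text are an3-g45's (LETTER SUPPLIER «AN3», `HOME/b2b-balaban-beta-an3/gen45/HPLetters.sketch.lean`
7da7f185de065953, part of `LETTER-AUDIT.v1.md` 67c354fb5f4d82d5, journal l.24906); the row-D1 owner (an2 gen 25) couriers it into the tree as ruled in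
R-D1-g25-2 (2) («I courier the two defs + `permLetter_of_HPS_HPW` … crediting an3»), with docstring tags and this header added; statements unchanged.

WHY ([Balaban1987RG1] p.292–293 (5.6)∕(5.12): the permutation law of the polarization tensor, used to reach (5.16)'s single β; R-D1-g25-1 (3)).  The comb
literal has no permutation letter (`CombPermutationWitness`); for «JsB12Sym» the symmetrised tables are S_D-covariant with NO compensator (a permutation
reverses no bond: `psite_unitVec`; the centred root is σ-fixed: `SymmetrisedAxialPotential.psite_ctr`), so the letters are plain `permK (axisPerm σ)`
covariance of the first-order stencil family `S` (HPS) and of the second-order bi-table `W` (HPW) — exactly the hypotheses (Sπ)∕(Wπ) of leaf-01's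
`permCovariant_flipK_TbalOf` (`permLetter_of_HPS_HPW`).  The closure lemmas (`permCovStencil_comp_left∕_right`, `_add_smul`, `permCovBiTable_sandwich`) are
the «hP-dress» propagation through composition with permutation-invariant kernels (`permK_KInv`, `permK_KInvStep`), linear combinations (pins, weights) and
sandwiches (the `S·G·S′` shape of second-order dressings).  NOT HERE: any proof that HPS∕HPW HOLD for the (0.4) tables (S2∕K3 of JSB12SYM-SPINE v1.1).
NOT D1, NOT BetaPertH, NOT continuum, NOT Clay.
HONEST DEPENDENCY (verbatim): «continuum YM on T⁴ ⇐ BetaPertH ∧ nine spine estimates (0/9 proved); BetaPertH ⇐ (D1) ∧ (D4) ∧ CAP+tail;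
G-an2-4 gates asym, D1 and NE2/3/4.»  ABSOLUTE RULE (cell, verbatim): «No internally-minted statement may enter as a cited fact. Every
hypothesis is either kernel-proved in this package or a verbatim quotation of a PUBLISHED theorem with page reference.»
-/

namespace Summit.QuantumFields.BalabanUV.Beta.PermutationLetters


noncomputable section

open Literature.MathematicalPhysics.QuantumFieldTheory.Balaban1983to89
open Literature.MathematicalPhysics.QuantumFieldTheory.Balaban1983to89.Beta
open B12Beta (PermCovariant)
open ExpKernelCalculus (MKer comp)
open OneStepResolventKernel (Fib JetData)
open OneStepKernelFamily (TbalOf flipK)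
open Summit.QuantumFields.BalabanUV.Beta.KernelPermutation
open Summit.QuantumFields.BalabanUV.Beta.ResolventPermutationStep (permCovariant_flipK_TbalOf)

variable {d : ℕ}

/-- [folklore] [our object] hP-S shape: PERMUTATION COVARIANCE OF A STENCIL FAMILY indexed by ONE bond `(κ, u)` (fine background bond or coarse bond):
`S (σ κ) (σ•u) = permK (axisPerm σ) (S κ u)` — NO compensator (a permutation reverses no bond orientation; the centred root is `σ`-fixed). -/
def PermCovStencil (S : Fin (d + 1) → (Fin (d + 1) → ℤ) → MKer (d + 1) (Fib d)) : Prop :=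
  ∀ (σ : Equiv.Perm (Fin (d + 1))) (κ : Fin (d + 1)) (u : Fin (d + 1) → ℤ), S (σ κ) (psite σ u) = permK (axisPerm σ) (S κ u)

/-- [folklore] [our object] hP-W ∕ hP-B shape: PERMUTATION COVARIANCE OF A BI-TABLE indexed by TWO bonds (`W μ y ν y′`, `vh₂S κ u κ′ u′`, `mixFF κ u ρ′ w`). -/
def PermCovBiTable (F : Fin (d + 1) → (Fin (d + 1) → ℤ) → Fin (d + 1) → (Fin (d + 1) → ℤ) → MKer (d + 1) (Fib d)) : Prop :=
  ∀ (σ : Equiv.Perm (Fin (d + 1))) (κ : Fin (d + 1)) (u : Fin (d + 1) → ℤ) (κ' : Fin (d + 1)) (u' : Fin (d + 1) → ℤ),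
    F (σ κ) (psite σ u) (σ κ') (psite σ u') = permK (axisPerm σ) (F κ u κ' u')

/-- [folklore] [our object] hP-K shape: PERMUTATION INVARIANCE OF A KERNEL (`KInv`, `KInvStep j`: PROVED as `permK_KInv`, `permK_KInvStep`; bordered Hessians, propagators). -/
def PermInvKer (K : MKer (d + 1) (Fib d)) : Prop :=
  ∀ σ : Equiv.Perm (Fin (d + 1)), permK (axisPerm σ) K = K

/-- [folklore] [our object] hP-S for a jet FAMILY: (Sπ) of `permCovariant_flipK_TbalOf`, by name. -/
def HPS {Lc : ℕ} (Js : ℕ → JetData d Lc) : Prop := ∀ j : ℕ, PermCovStencil (Js j).S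

/-- [folklore] [our object] hP-W for a jet FAMILY: (Wπ) of `permCovariant_flipK_TbalOf`, by name. -/
def HPW {Lc : ℕ} (Js : ℕ → JetData d Lc) : Prop := ∀ j : ℕ, PermCovBiTable (Js j).W

/-- [folklore] THE SHAPES MATCH (Sπ)∕(Wπ) VERBATIM: hP-S ∧ hP-W ⟹ the permutation letter of the one-step family (dimension four). -/
theorem permLetter_of_HPS_HPW {Lc : ℕ} [NeZero Lc] (Js : ℕ → JetData 3 Lc) (hS : HPS Js) (hW : HPW Js) :
    ∀ j : ℕ, PermCovariant (flipK (TbalOf Lc Js j)) :=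
  permCovariant_flipK_TbalOf Js (fun j σ κ' u => hS j σ κ' u) (fun j σ μ y ν y' => hW j σ μ y ν y')

/-! ## Closure shapes (hP-dress): the letters propagate through every algebraic operation of a dressing. -/

/-- [folklore] composition with an invariant kernel on the left preserves hP-S. -/
theorem permCovStencil_comp_left {K : MKer (d + 1) (Fib d)} {S : Fin (d + 1) → (Fin (d + 1) → ℤ) → MKer (d + 1) (Fib d)}
    (hK : PermInvKer K) (hS : PermCovStencil S) : PermCovStencil (fun κ u => comp K (S κ u)) := by
  intro σ κ u
  show comp K (S (σ κ) (psite σ u)) = permK (axisPerm σ) (comp K (S κ u))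
  rw [hS, ← comp_permK, hK σ]

/-- [folklore] composition with an invariant kernel on the right preserves hP-S. -/
theorem permCovStencil_comp_right {K : MKer (d + 1) (Fib d)} {S : Fin (d + 1) → (Fin (d + 1) → ℤ) → MKer (d + 1) (Fib d)}
    (hK : PermInvKer K) (hS : PermCovStencil S) : PermCovStencil (fun κ u => comp (S κ u) K) := by
  intro σ κ u
  show comp (S (σ κ) (psite σ u)) K = permK (axisPerm σ) (comp (S κ u) K)
  rw [hS, ← comp_permK, hK σ]

/-- [folklore] linear combinations preserve hP-S (pins and step weights are scalars). -/
theorem permCovStencil_add_smul {S S' : Fin (d + 1) → (Fin (d + 1) → ℤ) → MKer (d + 1) (Fib d)} (a b : ℝ)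
    (hS : PermCovStencil S) (hS' : PermCovStencil S') : PermCovStencil (fun κ u => a • S κ u + b • S' κ u) := by
  intro σ κ u
  show a • S (σ κ) (psite σ u) + b • S' (σ κ) (psite σ u) = permK (axisPerm σ) (a • S κ u + b • S' κ u)
  rw [hS, hS', permK_add, permK_smul, permK_smul]

/-- [folklore] the product of two hP-S families sandwiching an invariant kernel is an hP bi-table (the `S·G·S′` shape of second-order dressings). -/
theorem permCovBiTable_sandwich {K : MKer (d + 1) (Fib d)} {S S' : Fin (d + 1) → (Fin (d + 1) → ℤ) → MKer (d + 1) (Fib d)}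
    (hK : PermInvKer K) (hS : PermCovStencil S) (hS' : PermCovStencil S') :
    PermCovBiTable (fun κ u κ' u' => comp (S κ u) (comp K (S' κ' u'))) := by
  intro σ κ u κ' u'
  show comp (S (σ κ) (psite σ u)) (comp K (S' (σ κ') (psite σ u'))) = permK (axisPerm σ) (comp (S κ u) (comp K (S' κ' u')))
  rw [hS, hS', ← comp_permK, ← comp_permK, hK σ]

end

end Summit.QuantumFields.BalabanUV.Beta.PermutationLetters
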